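import Mathlib
import HarnessLib
import Summits.HubbardSuperconductivity.HubbardSuperconductivity.Theorems.KLProgrammeKLRegimeSplitPredicatesV3

/-!
# Route `KLProgramme` — K3 child `KLRegimeBetaSplit` (stmt-HubbardSuperconductivity-19635), line `birth`, Stub 4:
# (B4) first moments from (E4) `EngineFirstMoments`

Supplier row «(B4) `FirstMoments n` ⇐ (E4) `EngineFirstMoments n`» of the V2/V3 map: the engine delivers the first moments
with the constant `(cE4 + cE4'·|U|)·Klam·|U|·4ⁿ` (leading part absolute, `Q`-slack one power of `U` down); child 1's choice
`P.Cd ≥ G.cE4 + 1` and `U₀ ≤ 1/Q.cE4` (`Q.cE4·|U| ≤ 1`) give (B4)'s `Cd·Klam·|U|·4ⁿ`.  One line of arithmetic.  Cell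
gate-hubbard-kl, seat hubbard-kl-r2d-p1 (g0); registered stub of the skeleton `Lines/birth.lean` of 19635.
-/

noncomputable section

namespace Summit.HubbardSuperconductivity.HubbardSuperconductivity.Theorems.KLRegimeSplit

set_option linter.dupNamespace false -- summit = problem name (single-conjunct summit), D-0017

open Literature.MathematicalPhysics.QuantumLattice Literature.Probability.LatticeModels
open Summit.HubbardSuperconductivity.HubbardSuperconductivity.Theorems.KLProgrammeLegKernels

/-- **Stub 4 of line `birth` (child `KLRegimeBetaSplit`): (B4) from (E4).**  If `EngineFirstMoments … n` holds, `0 ≤ cE4, cE4', Klam`,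
`Q.cE4·|U| ≤ 1` and `G.cE4 + 1 ≤ P.Cd`, then `FirstMoments … n`. -/
theorem stub_firstMoments :
    ∀ (L M : ℕ) [NeZero L] [NeZero M] (G : GeoConsts) (P : SplitConsts) (Q : EngConsts) (β U μ : ℝ) (K : TrigPolyC4v)
      (n : ℕ), 0 ≤ G.cE4 → 0 ≤ Q.cE4 → 0 ≤ P.Klam → Q.cE4 * |U| ≤ 1 → G.cE4 + 1 ≤ P.Cd →
        EngineFirstMoments L M G P Q β U μ K n → FirstMoments L M P β U μ K n := by
  intro L M _ _ G P Q β U μ K n hG hQ hK hU hCd hE Ω i k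
  refine (hE Ω i k).trans ?_
  have h1 : G.cE4 + Q.cE4 * |U| ≤ P.Cd := by linarith
  have h2 : 0 ≤ P.Klam * |U| * (4 : ℝ) ^ n := by positivity
  calc (G.cE4 + Q.cE4 * |U|) * P.Klam * |U| * (4 : ℝ) ^ n = (G.cE4 + Q.cE4 * |U|) * (P.Klam * |U| * (4 : ℝ) ^ n) := by ring
    _ ≤ P.Cd * (P.Klam * |U| * (4 : ℝ) ^ n) := mul_le_mul_of_nonneg_right h1 h2
    _ = P.Cd * P.Klam * |U| * (4 : ℝ) ^ n := by ring

end Summit.HubbardSuperconductivity.HubbardSuperconductivity.Theorems.KLRegimeSplit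

end
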